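import Literature.Geometry.Symplectic.TaubesFamilyBetaWeitzenbock
import HarnessLib

/-!
# Hutchings–Taubes (4.15) for the family `(SW_r)`: `∫|∂̄'α|² + ½∫|α|²|β|² = 2∫Re⟨β, b·∇'α⟩`

Topic `Literature/Geometry/Symplectic`; the cross-term identity of Step 3 of the proof of
`SW(K⁻¹) = ±1` (Hutchings–Taubes (1999) (4.15) "`∫|∂̄_a^*β|² = ∫⟨β, N(∂_aα)⟩ - ∫ r|α|²|β|²`",
Taubes (1994) §3 (17)–(18)), for a solution `(A, ψ = αu₀ + β)` of the Seiberg–Witten equations of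
`𝔰_J` with perturbation `P₊F_{A₀} - (r/4)s`, in the tree's scaling and in spinor language.

With `θ_k = ∇'_{e_k}α` (`∇' = d + ia`, `a = ½(A - A₀)`), `b_k = b(e_k)` Taubes's torsion
(`canonicalTorsion`, the `K⁻¹`-component of `∇̃u₀` — the Nijenhuis tensor), `β = ψ_{u₁}`, all read in
the unitary frame of the chart at the point:

  `∫_N (|D_Aβ|² + ½|α|²|β|² - 2 Σ_k Re(θ_k b_k β̄))(s ∧ s) = 0`

(`integral_crossTerm_eq_zero`), where `|D_Aβ|² = |∇'₀α+i∇'₁α|² + |∇'₂α+i∇'₃α|²`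
(`TaubesFamilyDiracBetaEnergy`).  Proof (first order throughout, no second covariant derivatives):
the integrand is the sum of three divergences — of `Re⟨β, γ(·)D_A(αu₀)⟩` (Dirac adjointness:
`Re⟨β, D_A²(αu₀)⟩ + |D_Aβ|²`, using `D_Aβ = -D_A(αu₀)`), of `Re⟨β, ∇̃^A(αu₀)⟩` (Bochner:
`Σ_k Re⟨∇̃_kβ, ∇̃_k(αu₀)⟩ - Re⟨β, ∇^*∇(αu₀)⟩`) and minus that of `Re⟨ᾱβ, ∇̃^{A₀}u₀⟩` — combined with
the pointwise Weitzenböck formula for `αu₀` (connection `A`) and for `u₀` (connection `A₀`,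
`D_{A₀}u₀ = 0`), the Leibniz rule `∇̃_k(αu₀) = θ_k u₀ + αb_k u₁`, `⟨u₀, ∇̃_kβ⟩ = -b̄_k β` (the spin
connection is skew-Hermitian), and the curvature equation, whose `K⁻¹u₀`-component gives
`Re⟨ᾱβ, ½i(F_A - F_{A₀})·u₀⟩ = ½|α|²|β|²` (the `P₊F_{A₀}` of the perturbation cancels `F_{A₀}`).

PROVED, 0 named facts.

## References

* M. Hutchings, C. H. Taubes, *An introduction to the Seiberg–Witten equations on symplectic
  manifolds*, IAS/Park City Math. Ser. 7 (1999; AMS 2006), §4.5 (4.15). [HutchingsTaubes2006]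
* C. H. Taubes, *The Seiberg–Witten invariants and symplectic forms*, Math. Res. Lett. 1 (1994)
  809–822, §3 (17)–(18). [Taubes1994]
-/

noncomputable section

open scoped Manifold ContDiff Topology ComplexConjugate Matrix
open Set Function Filter Complex Literature.Geometry.Kaehler Literature.Geometry.GaugeTheory Literature.Topology.FourManifolds
open Literature.Geometry.Lorentzian (PseudoRiemannianMetric)
open Literature.Geometry.Manifold Literature.Geometry.Manifold.DeRhamSignFour Literature.NumberTheory.Transcendental

namespace Literature.Geometry.Symplectic

open Literature.Geometry.GaugeTheory.SpincStructure

namespace AlmostComplexStructure.IsCompatibleWith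

variable {N : Type} [TopologicalSpace N] [ChartedSpace (EuclideanSpace ℝ (Fin 4)) N] [IsManifold (𝓡 4) ∞ N]
  {J : AlmostComplexStructure (𝓡 4) ∞ N} {s : MForm (𝓡 4) N ℝ 2}
  (h : J.IsCompatibleWith s) (hs : IsSmoothForm s)
  (hnd : ∀ x (v : TangentSpace (𝓡 4) x), v ≠ 0 → ∃ w : TangentSpace (𝓡 4) x, s x ![v, w] ≠ 0)

/-! ### First-order calculus in the splitting `S⁺ = ℂu₀ ⊕ ℂu₁` -/

/-- **`∇̃^A = ∇̃^{A₀} + ia`** on spinors (`A = A₀ + 2a` on `det`, `½iA = ½iA₀ + ia`). [cite: HutchingsTaubes2006, §4.3] -/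
theorem covDeriv_conn_eq [(h.metric hs).HasLeviCivita] (cfg : (h.canonicalSpincStructure hs hnd).Configuration)
    (ψ : SpinorField (h.canonicalSpincStructure hs hnd)) (i : N) {x : N}
    (hx : x ∈ (h.canonicalSpincStructure hs hnd).baseSet i) (v : TangentSpace (𝓡 4) x) :
    covDeriv cfg.conn ψ i x v = covDeriv (h.taubesConnection hs hnd) ψ i x v +
      (I * ((h.halfConnectionDiff hs hnd cfg x v : ℝ) : ℂ)) • ψ.toFun i x := by
  have hform : cfg.conn.form i x v = (h.taubesConnection hs hnd).form i x v + 2 * h.halfConnectionDiff hs hnd cfg x v := by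
    rw [h.conn_form_eq hs hnd cfg i hx]
    simp [CircleCocycle.Connection.addForm]
  simp only [covDeriv, hform]
  rw [show (2 : ℂ)⁻¹ * (I * (((h.taubesConnection hs hnd).form i x v + 2 * h.halfConnectionDiff hs hnd cfg x v : ℝ) : ℂ)) =
      (2 : ℂ)⁻¹ * (I * (((h.taubesConnection hs hnd).form i x v : ℝ) : ℂ)) + I * ((h.halfConnectionDiff hs hnd cfg x v : ℝ) : ℂ) by
    push_cast; ring, add_smul]
  abel

/-- **`∇̃^A_v u₀ = b(v)u₁ + ia(v)u₀`.** [cite: Taubes1994, §1 (1)] [cite: HutchingsTaubes2006, §4.3] -/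
theorem covDeriv_conn_canonicalSpinor [(h.metric hs).HasLeviCivita] (cfg : (h.canonicalSpincStructure hs hnd).Configuration)
    (i : N) {x : N} (hx : x ∈ (h.canonicalSpincStructure hs hnd).baseSet i) (v : TangentSpace (𝓡 4) x) :
    covDeriv cfg.conn (h.canonicalSpinor hs hnd) i x v =
      (h.unitaryAdaptedFrames hs hnd).canonicalTorsion i x v • detUnit +
        (I * ((h.halfConnectionDiff hs hnd cfg x v : ℝ) : ℂ)) • plusUnit := by
  rw [h.covDeriv_conn_eq hs hnd cfg _ i hx, h.covDeriv_taubesConnection_canonicalSpinor hs hnd, canonicalSpinor_toFun]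

/-- **Leibniz: `∇̃^A_v(αu₀) = (∇'_vα)u₀ + αb(v)u₁`**, `∇'α = dα + iaα`. [cite: HutchingsTaubes2006, §4.3 (4.8)] -/
theorem covDeriv_conn_smul_canonicalSpinor [(h.metric hs).HasLeviCivita] (cfg : (h.canonicalSpincStructure hs hnd).Configuration)
    (i : N) {x : N} (hx : x ∈ (h.canonicalSpincStructure hs hnd).baseSet i) (v : TangentSpace (𝓡 4) x) :
    covDeriv cfg.conn (h.alphaFun hs hnd cfg • h.canonicalSpinor hs hnd) i x v =
      connDeriv (h.alphaFun hs hnd cfg) (h.halfConnectionDiff hs hnd cfg) x v • plusUnit +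
        (h.alphaFun hs hnd cfg x * (h.unitaryAdaptedFrames hs hnd).canonicalTorsion i x v) • detUnit := by
  have hα := ((h.contMDiff_alphaFun hs hnd cfg) x).mdifferentiableAt (by simp)
  rw [covDeriv_smul_fun _ hα (h.spinorMDiffAt_canonicalSpinor hs hnd i x), canonicalSpinor_toFun,
    h.covDeriv_conn_canonicalSpinor hs hnd cfg i hx, smul_add, smul_smul, smul_smul, connDeriv, add_smul,
    mul_comm (h.alphaFun hs hnd cfg x) (I * _)]
  abel

/-- **`⟨u₀, ∇̃_v(fβ)⟩ = -b̄(v)fβ`**: the `u₀`-component of the covariant derivative of a multiple of `β`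
(`β` has no `u₀`-component and the spin connection is skew-Hermitian: `dρ(ω̃)_{u₀u₁} = -conj(b)`).
[cite: Taubes1994, §3 (17)] -/
theorem covDeriv_smul_betaField_inl_one [(h.metric hs).HasLeviCivita] (A : (h.canonicalSpincStructure hs hnd).detLineBundle.Connection)
    (cfg : (h.canonicalSpincStructure hs hnd).Configuration) (f : N → ℂ) (i : N) {x : N}
    (hx : x ∈ (h.canonicalSpincStructure hs hnd).baseSet i) (v : TangentSpace (𝓡 4) x) :
    covDeriv A (f • h.betaField hs hnd cfg) i x v (Sum.inl 1) =
      -(conj ((h.unitaryAdaptedFrames hs hnd).canonicalTorsion i x v) * (f x * cfg.plusSpinor i x 0)) := by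
  -- the derivative term vanishes: the `u₀`-component of `fβ` is zero on the chart
  have hzero : (fun y ↦ (f • h.betaField hs hnd cfg).toFun i y (Sum.inl 1)) =ᶠ[𝓝 x] fun _ ↦ (0 : ℂ) := by
    filter_upwards [((h.canonicalSpincStructure hs hnd).isOpen_baseSet i).mem_nhds hx] with y hy
    simp [h.betaField_toFun_inl_one hs hnd cfg i hy]
  have hd : spinorDeriv ((f • h.betaField hs hnd cfg).toFun i) x v (Sum.inl 1) = 0 := by
    change mfderiv (𝓡 4) 𝓘(ℝ, ℂ) (fun y ↦ (f • h.betaField hs hnd cfg).toFun i y (Sum.inl 1)) x v = 0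
    rw [hzero.mfderiv_eq, mfderiv_const]
    rfl
  -- the skew-Hermitian spin connection
  have hskew : (h.canonicalSpincStructure hs hnd).spinConnectionEnd i x v (Sum.inl 1) (Sum.inl 0) =
      -conj ((h.unitaryAdaptedFrames hs hnd).canonicalTorsion i x v) := by
    have hc := congrFun (congrFun ((h.canonicalSpincStructure hs hnd).conjTranspose_spinConnectionEnd i x v) (Sum.inl 0)) (Sum.inl 1)
    simp only [Matrix.conjTranspose_apply, Matrix.neg_apply] at hc
    rw [← star_star ((h.canonicalSpincStructure hs hnd).spinConnectionEnd i x v (Sum.inl 1) (Sum.inl 0)), hc, star_neg]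
    rfl
  have hx1 : (f • h.betaField hs hnd cfg).toFun i x (Sum.inl 1) = 0 := by simp [h.betaField_toFun_inl_one hs hnd cfg i hx]
  have hxr : ∀ b, (f • h.betaField hs hnd cfg).toFun i x (Sum.inr b) = 0 := fun b ↦ by
    simp [h.betaField_toFun_inr hs hnd cfg i hx]
  have hx0 : (f • h.betaField hs hnd cfg).toFun i x (Sum.inl 0) = f x * cfg.plusSpinor i x 0 := by
    simp [SpincStructure.Configuration.plusSpinor]
  rw [covDeriv, Pi.add_apply, Pi.add_apply, hd, Pi.smul_apply, hx1, smul_zero, zero_add, zero_add, Matrix.mulVec,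
    dotProduct, Fintype.sum_sum_type, Fin.sum_univ_two, Fin.sum_univ_two, hx0, hx1, hxr, hxr, hskew]
  ring

/-- `⟨β, w⟩ = β̄ w_{u₁}` on the chart. [folklore] -/
theorem star_betaField_dotProduct (cfg : (h.canonicalSpincStructure hs hnd).Configuration) (i : N) {x : N}
    (hx : x ∈ (h.canonicalSpincStructure hs hnd).baseSet i) (w : Spinor → ℂ) :
    star ((h.betaField hs hnd cfg).toFun i x) ⬝ᵥ w = conj (cfg.plusSpinor i x 0) * w (Sum.inl 0) := by
  rw [h.betaField_toFun_eq_sumElim hs hnd cfg i hx, dotProduct, Fintype.sum_sum_type, Fin.sum_univ_two, Fin.sum_univ_two]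
  simp

/-- `⟨ᾱβ, w⟩ = α β̄ w_{u₁}` on the chart. [folklore] -/
theorem star_conj_alphaFun_smul_betaField_dotProduct (cfg : (h.canonicalSpincStructure hs hnd).Configuration) (i : N) {x : N}
    (hx : x ∈ (h.canonicalSpincStructure hs hnd).baseSet i) (w : Spinor → ℂ) :
    star (((fun y ↦ conj (h.alphaFun hs hnd cfg y)) • h.betaField hs hnd cfg).toFun i x) ⬝ᵥ w =
      h.alphaFun hs hnd cfg x * conj (cfg.plusSpinor i x 0) * w (Sum.inl 0) := by
  rw [SpinorField.smulFun_toFun, star_smul, smul_dotProduct, h.star_betaField_dotProduct hs hnd cfg i hx w, Complex.star_def,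
    Complex.conj_conj, smul_eq_mul, mul_assoc]

/-- `⟨w, u₀⟩`, `⟨w, u₁⟩` read off components. [folklore] -/
theorem star_dotProduct_smul_plusUnit_add_smul_detUnit (w : Spinor → ℂ) (p q : ℂ) :
    star w ⬝ᵥ (p • plusUnit + q • detUnit) = p * conj (w (Sum.inl 1)) + q * conj (w (Sum.inl 0)) := by
  rw [dotProduct, Fintype.sum_sum_type, Fin.sum_univ_two, Fin.sum_univ_two]
  simp [plusUnit, detUnit]
  ring

/-! ### The cross term: `Σ_k Re⟨∇̃^A_kβ, ∇̃^A_k(αu₀)⟩ - Σ_k Re⟨∇̃^{A₀}_k(ᾱβ), ∇̃^{A₀}_ku₀⟩ = -2Σ_k Re(θ_k b_k β̄)` -/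

/-- **The first-order cross-term identity** (pointwise, on a chart): with `θ_k = ∇'_{e_k}α`,
`b_k = b(e_k)`, `β = ψ_{u₁}`,
`Σ_k Re⟨∇̃^A_kβ, ∇̃^A_k(αu₀)⟩ - Σ_k Re⟨∇̃^{A₀}_k(ᾱβ), ∇̃^{A₀}_ku₀⟩ = -2 Σ_k Re(θ_k b_k β̄)` — the
`∇̃β`-terms and the `a`-terms cancel. [cite: HutchingsTaubes2006, §4.5 (4.15)] [cite: Taubes1994, §3 (17)] -/
theorem crossTerm_pointwise [(h.metric hs).HasLeviCivita] (cfg : (h.canonicalSpincStructure hs hnd).Configuration)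
    (i : N) {x : N} (hx : x ∈ (h.canonicalSpincStructure hs hnd).baseSet i) :
    (∑ k, (star (covDeriv cfg.conn (h.betaField hs hnd cfg) i x ((h.canonicalSpincStructure hs hnd).frame i k x)) ⬝ᵥ
        covDeriv cfg.conn (h.alphaFun hs hnd cfg • h.canonicalSpinor hs hnd) i x ((h.canonicalSpincStructure hs hnd).frame i k x)).re) -
      (∑ k, (star (covDeriv (h.taubesConnection hs hnd) ((fun y ↦ conj (h.alphaFun hs hnd cfg y)) • h.betaField hs hnd cfg) i x
          ((h.canonicalSpincStructure hs hnd).frame i k x)) ⬝ᵥ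
        covDeriv (h.taubesConnection hs hnd) (h.canonicalSpinor hs hnd) i x ((h.canonicalSpincStructure hs hnd).frame i k x)).re) =
      -2 * ∑ k, (connDeriv (h.alphaFun hs hnd cfg) (h.halfConnectionDiff hs hnd cfg) x ((h.canonicalSpincStructure hs hnd).frame i k x) *
        (h.unitaryAdaptedFrames hs hnd).canonicalTorsion i x ((h.canonicalSpincStructure hs hnd).frame i k x) *
          conj (cfg.plusSpinor i x 0)).re := by
  rw [Finset.mul_sum, ← Finset.sum_sub_distrib]
  refine Finset.sum_congr rfl fun k _ ↦ ?_
  have hα := ((h.contMDiff_alphaFun hs hnd cfg) x).mdifferentiableAt (by simp)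
  have hαc : MDifferentiableAt (𝓡 4) 𝓘(ℝ, ℂ) (fun y ↦ conj (h.alphaFun hs hnd cfg y)) x :=
    ((Complex.conjCLE : ℂ ≃L[ℝ] ℂ).contDiff.comp_contMDiff (h.contMDiff_alphaFun hs hnd cfg) x).mdifferentiableAt (by simp)
  have hβ := (h.isSmooth_betaField hs hnd cfg).spinorMDiffAt hx
  set v := (h.canonicalSpincStructure hs hnd).frame i k x with hv
  -- abbreviations
  set θ := connDeriv (h.alphaFun hs hnd cfg) (h.halfConnectionDiff hs hnd cfg) x v with hθ
  set τ := (h.unitaryAdaptedFrames hs hnd).canonicalTorsion i x v with hτ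
  set β := cfg.plusSpinor i x 0 with hβdef
  set al := h.alphaFun hs hnd cfg x with hal
  set ar : ℝ := h.halfConnectionDiff hs hnd cfg x v with har
  -- the two covariant derivatives of `β`-type fields, `u₁`-components kept symbolic
  set D := covDeriv cfg.conn (h.betaField hs hnd cfg) i x v (Sum.inl 0) with hD
  have hD1 : covDeriv cfg.conn (h.betaField hs hnd cfg) i x v (Sum.inl 1) = -(conj τ * β) := by
    have := h.covDeriv_smul_betaField_inl_one hs hnd cfg.conn cfg (fun _ ↦ (1 : ℂ)) i hx v
    simp only [one_mul] at this
    rw [← this]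
    congr 2
    ext j y a
    simp
  -- `∇̃^{A₀}_v(ᾱβ) = (dᾱ(v))β + ᾱ(∇̃^A_vβ - ia(v)β)`
  have hE0 : covDeriv (h.taubesConnection hs hnd) ((fun y ↦ conj (h.alphaFun hs hnd cfg y)) • h.betaField hs hnd cfg) i x v (Sum.inl 0) =
      conj (complexDeriv (h.alphaFun hs hnd cfg) x v) * β + conj al * (D - I * (ar : ℂ) * β) := by
    rw [covDeriv_smul_fun _ hαc hβ, complexDeriv_conj_fun hα]
    have hA0 : covDeriv (h.taubesConnection hs hnd) (h.betaField hs hnd cfg) i x v =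
        covDeriv cfg.conn (h.betaField hs hnd cfg) i x v - (I * ((h.halfConnectionDiff hs hnd cfg x v : ℝ) : ℂ)) • (h.betaField hs hnd cfg).toFun i x := by
      rw [h.covDeriv_conn_eq hs hnd cfg _ i hx]; abel
    rw [hA0]
    simp [SpincStructure.Configuration.plusSpinor, hD, hβdef, hal, har]
  have hE1 : covDeriv (h.taubesConnection hs hnd) ((fun y ↦ conj (h.alphaFun hs hnd cfg y)) • h.betaField hs hnd cfg) i x v (Sum.inl 1) =
      -(conj τ * (conj al * β)) :=
    h.covDeriv_smul_betaField_inl_one hs hnd _ cfg _ i hx v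
  rw [h.covDeriv_conn_smul_canonicalSpinor hs hnd cfg i hx v, h.covDeriv_taubesConnection_canonicalSpinor hs hnd,
    star_dotProduct_smul_plusUnit_add_smul_detUnit, hD1]
  rw [show (τ • detUnit : Spinor → ℂ) = (0 : ℂ) • plusUnit + τ • detUnit by simp, star_dotProduct_smul_plusUnit_add_smul_detUnit,
    hE0, hE1]
  -- `θ = dα(v) + ia(v)α`
  have hθ' : complexDeriv (h.alphaFun hs hnd cfg) x v = θ - I * (ar : ℂ) * al := by
    simp only [hθ, connDeriv, hal, har]; ring
  rw [hθ']
  simp only [map_neg, map_mul, Complex.conj_conj, map_sub, Complex.conj_I, Complex.conj_ofReal, Complex.sub_re, Complex.add_re,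
    Complex.neg_re, Complex.mul_re, Complex.mul_im, Complex.sub_im, Complex.add_im, Complex.neg_im, Complex.conj_re, Complex.conj_im,
    Complex.I_re, Complex.I_im, Complex.ofReal_re, Complex.ofReal_im, zero_mul, mul_zero, sub_zero, zero_add, one_mul]
  ring

/-! ### The curvature terms and the Weitzenböck formula for `u₀` -/

/-- `u₀ = ((0, 1), 0)` in the fibre model. [folklore] -/
theorem _root_.Literature.Geometry.GaugeTheory.plusUnit_eq_sumElim : plusUnit = Sum.elim ![(0 : ℂ), 1] 0 := by
  funext a
  rcases a with a | a <;> fin_cases a <;> simp [plusUnit]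

/-- `(ρ(Ω)u₀)_{u₁} = ρ⁺(Ω)₀₁`. [cite: MorganSWBook1996, Lemma 2.3.4] -/
theorem _root_.Literature.Geometry.GaugeTheory.cliffordTwoForm_mulVec_plusUnit_inl_zero {Ω : Matrix (Fin 4) (Fin 4) ℝ}
    (hΩ : IsTwoForm Ω) : (cliffordTwoForm Ω *ᵥ plusUnit) (Sum.inl 0) = plusAction Ω 0 1 := by
  rw [cliffordTwoForm_eq_fromBlocks hΩ, plusUnit_eq_sumElim, Matrix.fromBlocks_mulVec, Sum.elim_comp_inl, Sum.elim_comp_inr]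
  simp

/-- A local Dirac operator applied to a function vanishing near the point vanishes there. [folklore] -/
theorem localDirac_eq_zero_of_eventuallyEq [(h.metric hs).HasLeviCivita] (A : (h.canonicalSpincStructure hs hnd).detLineBundle.Connection) (i : N)
    {f : N → Spinor → ℂ} {x : N} (hf : f =ᶠ[𝓝 x] fun _ ↦ 0) : (h.canonicalSpincStructure hs hnd).localDirac A i f x = 0 := by
  have hd : ∀ v : TangentSpace (𝓡 4) x, spinorDeriv f x v = 0 := by
    intro v
    funext a
    have ha : (fun y ↦ f y a) =ᶠ[𝓝 x] fun _ ↦ (0 : ℂ) := hf.mono fun y hy ↦ by simp [hy]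
    change mfderiv (𝓡 4) 𝓘(ℝ, ℂ) (fun y ↦ f y a) x v = 0
    rw [ha.mfderiv_eq, mfderiv_const]
    rfl
  simp [SpincStructure.localDirac, SpincStructure.localCovDeriv, hd, hf.self_of_nhds]

/-- **The Weitzenböck formula for `u₀` with `D_{A₀}u₀ = 0`**:
`∇^*_{A₀}∇_{A₀}u₀ = -(κ/4)u₀ - ½iF_{A₀}·u₀` on each chart. [cite: Taubes1994, §3 (17)] -/
theorem localLaplacian_taubesConnection_canonicalSpinor [(h.metric hs).HasLeviCivita] (hcl : IsClosedForm s) (i : N) {x : N}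
    (hx : x ∈ (h.canonicalSpincStructure hs hnd).baseSet i) :
    (h.canonicalSpincStructure hs hnd).localLaplacian (h.taubesConnection hs hnd) i ((h.canonicalSpinor hs hnd).toFun i) x =
      -(((4 : ℂ)⁻¹ * (((h.canonicalSpincStructure hs hnd).frameScalarCurv i x : ℝ) : ℂ)) • plusUnit) -
        ((2 : ℂ)⁻¹ * I) • (cliffordTwoForm ((h.canonicalSpincStructure hs hnd).extDerivMatrix ((h.taubesConnection hs hnd).form i) i x) *ᵥ plusUnit) := by
  have hW := (h.canonicalSpincStructure hs hnd).localDirac_dirac (h.taubesConnection hs hnd) (h.isSmooth_canonicalSpinor hs hnd) hx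
  have h0 : (h.canonicalSpincStructure hs hnd).localDirac (h.taubesConnection hs hnd) i (fun y ↦ dirac (h.taubesConnection hs hnd) (h.canonicalSpinor hs hnd) i y) x = 0 := by
    apply h.localDirac_eq_zero_of_eventuallyEq hs hnd
    filter_upwards [((h.canonicalSpincStructure hs hnd).isOpen_baseSet i).mem_nhds hx] with y hy
    exact h.dirac_taubesConnection_canonicalSpinor_eq_zero hs hnd hcl i hy
  rw [h0, canonicalSpinor_toFun] at hW
  have := hW.symm
  rw [add_assoc, add_eq_zero_iff_eq_neg] at this
  rw [this, neg_add]
  abel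

/-- **The `K⁻¹u₀`-component of the curvature equation, paired with `ᾱβ`**:
`Re⟨β, ½iF_A·(αu₀)⟩ - Re⟨ᾱβ, ½iF_{A₀}·u₀⟩ = ½|α|²|β|²` for a solution of the family (the `P₊F_{A₀}` in
the perturbation cancels `F_{A₀}`; `q(ψ)₀₁ = βᾱ`; `ρ⁺(s)` is diagonal). [cite: HutchingsTaubes2006, §4.4 (4.12)]
[cite: Taubes1994, §3 (17)–(18)] -/
theorem re_curvature_pairing_cross_eq [(h.metric hs).HasLeviCivita] (c : ℂ) {cfg : (h.canonicalSpincStructure hs hnd).Configuration}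
    (hsol : SpincStructure.IsSolution (h.taubesPerturbation hs hnd - h.symplecticPerturbation hs hnd (Complex.normSq c / 4)) cfg)
    (i : N) {x : N} (hx : x ∈ (h.canonicalSpincStructure hs hnd).baseSet i) :
    (star ((h.betaField hs hnd cfg).toFun i x) ⬝ᵥ (((2 : ℂ)⁻¹ * I) •
        (cliffordTwoForm ((h.canonicalSpincStructure hs hnd).extDerivMatrix (cfg.conn.form i) i x) *ᵥ (h.alphaFun hs hnd cfg • h.canonicalSpinor hs hnd).toFun i x))).re -
      (star (((fun y ↦ conj (h.alphaFun hs hnd cfg y)) • h.betaField hs hnd cfg).toFun i x) ⬝ᵥ (((2 : ℂ)⁻¹ * I) •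
        (cliffordTwoForm ((h.canonicalSpincStructure hs hnd).extDerivMatrix ((h.taubesConnection hs hnd).form i) i x) *ᵥ (h.canonicalSpinor hs hnd).toFun i x))).re =
      2⁻¹ * Complex.normSq (h.alphaFun hs hnd cfg x) * Complex.normSq (cfg.plusSpinor i x 0) := by
  have hoff := h.offDiag_curvature_eq_of_isSolution hs hnd (h.taubesPerturbation hs hnd) c hsol i hx
  rw [taubesPerturbation_form, (h.canonicalSpincStructure hs hnd).twoFormMatrix_sdCurvatureForm _ _ hx,
    sdCoeff_sdMatrix ((h.canonicalSpincStructure hs hnd).isTwoForm_curvatureMatrix _ _ _),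
    ← I_smul_plusAction_apply_zero_one, ← I_smul_plusAction_apply_zero_one, ← h.alphaFun_eq hs hnd cfg i hx] at hoff
  rw [h.star_betaField_dotProduct hs hnd cfg i hx, h.star_conj_alphaFun_smul_betaField_dotProduct hs hnd cfg i hx,
    SpinorField.smulFun_toFun, canonicalSpinor_toFun, Matrix.mulVec_smul, ← curvatureMatrix_eq_extDerivMatrix,
    ← curvatureMatrix_eq_extDerivMatrix]
  simp only [Pi.smul_apply, smul_eq_mul, cliffordTwoForm_mulVec_plusUnit_inl_zero ((h.canonicalSpincStructure hs hnd).isTwoForm_curvatureMatrix _ _ _)]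
  have h1 : ∀ Ω : Matrix (Fin 4) (Fin 4) ℝ, (2 : ℂ)⁻¹ * I * plusAction Ω 0 1 = (2 : ℂ)⁻¹ * (I • plusAction Ω) 0 1 := fun Ω ↦ by
    simp [Matrix.smul_apply]; ring
  have key : conj (cfg.plusSpinor i x 0) * ((2 : ℂ)⁻¹ * I * (h.alphaFun hs hnd cfg x * plusAction ((h.canonicalSpincStructure hs hnd).curvatureMatrix cfg.conn i x) 0 1)) -
      h.alphaFun hs hnd cfg x * conj (cfg.plusSpinor i x 0) * ((2 : ℂ)⁻¹ * I * plusAction ((h.canonicalSpincStructure hs hnd).curvatureMatrix (h.taubesConnection hs hnd) i x) 0 1) =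
      (2 : ℂ)⁻¹ * (h.alphaFun hs hnd cfg x * conj (cfg.plusSpinor i x 0)) *
        ((I • plusAction ((h.canonicalSpincStructure hs hnd).curvatureMatrix cfg.conn i x)) 0 1 - (I • plusAction ((h.canonicalSpincStructure hs hnd).curvatureMatrix (h.taubesConnection hs hnd) i x)) 0 1) := by
    simp only [Matrix.smul_apply, smul_eq_mul]; ring
  rw [← Complex.sub_re, key, hoff]
  have hn : (2 : ℂ)⁻¹ * (h.alphaFun hs hnd cfg x * conj (cfg.plusSpinor i x 0)) * (cfg.plusSpinor i x 0 * conj (h.alphaFun hs hnd cfg x)) =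
      ((2⁻¹ * Complex.normSq (h.alphaFun hs hnd cfg x) * Complex.normSq (cfg.plusSpinor i x 0) : ℝ) : ℂ) := by
    push_cast
    rw [Complex.normSq_eq_conj_mul_self, Complex.normSq_eq_conj_mul_self]
    ring
  rw [hn, Complex.ofReal_re]

/-! ### The pointwise identity and the integral -/

/-- **The cross-term integrand is a sum of three divergences** (pointwise, on a chart):
`|D_Aβ|² + ½|α|²|β|² - 2Σ_k Re(θ_k b_k β̄)
 = (Re⟨β, D_A(D_A(αu₀))⟩ - Re⟨D_Aβ, D_A(αu₀)⟩) + (Σ_k Re⟨∇̃^A_kβ, ∇̃^A_k(αu₀)⟩ - Re⟨β, ∇_A^*∇_A(αu₀)⟩)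
   - (Σ_k Re⟨∇̃^{A₀}_k(ᾱβ), ∇̃^{A₀}_ku₀⟩ - Re⟨ᾱβ, ∇_{A₀}^*∇_{A₀}u₀⟩)`.
[cite: HutchingsTaubes2006, §4.5 (4.15)] [cite: Taubes1994, §3 (17)–(18)] -/
theorem crossTerm_integrand_eq [(h.metric hs).HasLeviCivita] (hcl : IsClosedForm s) (c : ℂ) {cfg : (h.canonicalSpincStructure hs hnd).Configuration}
    (hsol : SpincStructure.IsSolution (h.taubesPerturbation hs hnd - h.symplecticPerturbation hs hnd (Complex.normSq c / 4)) cfg)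
    (i : N) {x : N} (hx : x ∈ (h.canonicalSpincStructure hs hnd).baseSet i) :
    spinorHermNormSq (dirac cfg.conn (h.betaField hs hnd cfg) i x) + 2⁻¹ * Complex.normSq (h.alphaFun hs hnd cfg x) * Complex.normSq (cfg.plusSpinor i x 0) -
      2 * ∑ k, (connDeriv (h.alphaFun hs hnd cfg) (h.halfConnectionDiff hs hnd cfg) x ((h.canonicalSpincStructure hs hnd).frame i k x) *
        (h.unitaryAdaptedFrames hs hnd).canonicalTorsion i x ((h.canonicalSpincStructure hs hnd).frame i k x) * conj (cfg.plusSpinor i x 0)).re =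
      ((star ((h.betaField hs hnd cfg).toFun i x) ⬝ᵥ
          dirac cfg.conn ((h.canonicalSpincStructure hs hnd).diracField cfg.conn ((h.isSmooth_canonicalSpinor hs hnd).smulFun (h.contMDiff_alphaFun hs hnd cfg))) i x).re -
        (star (dirac cfg.conn (h.betaField hs hnd cfg) i x) ⬝ᵥ
          ((h.canonicalSpincStructure hs hnd).diracField cfg.conn ((h.isSmooth_canonicalSpinor hs hnd).smulFun (h.contMDiff_alphaFun hs hnd cfg))).toFun i x).re) +
      ((∑ k, (star (covDeriv cfg.conn (h.betaField hs hnd cfg) i x ((h.canonicalSpincStructure hs hnd).frame i k x)) ⬝ᵥ covDeriv cfg.conn (h.alphaFun hs hnd cfg • h.canonicalSpinor hs hnd) i x ((h.canonicalSpincStructure hs hnd).frame i k x)).re) -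
        (star ((h.betaField hs hnd cfg).toFun i x) ⬝ᵥ (h.canonicalSpincStructure hs hnd).localLaplacian cfg.conn i ((h.alphaFun hs hnd cfg • h.canonicalSpinor hs hnd).toFun i) x).re) -
      ((∑ k, (star (covDeriv (h.taubesConnection hs hnd) ((fun y ↦ conj (h.alphaFun hs hnd cfg y)) • h.betaField hs hnd cfg) i x ((h.canonicalSpincStructure hs hnd).frame i k x)) ⬝ᵥ covDeriv (h.taubesConnection hs hnd) (h.canonicalSpinor hs hnd) i x ((h.canonicalSpincStructure hs hnd).frame i k x)).re) -
        (star (((fun y ↦ conj (h.alphaFun hs hnd cfg y)) • h.betaField hs hnd cfg).toFun i x) ⬝ᵥ (h.canonicalSpincStructure hs hnd).localLaplacian (h.taubesConnection hs hnd) i ((h.canonicalSpinor hs hnd).toFun i) x).re) := by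
  have hαu : (h.alphaFun hs hnd cfg • h.canonicalSpinor hs hnd).IsSmooth := (h.isSmooth_canonicalSpinor hs hnd).smulFun (h.contMDiff_alphaFun hs hnd cfg)
  -- `D_A(D_A(αu₀))` by the Weitzenböck formula for `αu₀`
  have hdd : dirac cfg.conn ((h.canonicalSpincStructure hs hnd).diracField cfg.conn hαu) i x =
      (h.canonicalSpincStructure hs hnd).localDirac cfg.conn i (fun y ↦ dirac cfg.conn (h.alphaFun hs hnd cfg • h.canonicalSpinor hs hnd) i y) x := by
    rw [(h.canonicalSpincStructure hs hnd).dirac_eq_localDirac]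
    rfl
  have hW := (h.canonicalSpincStructure hs hnd).localDirac_dirac cfg.conn hαu hx
  -- `D_A(αu₀) = -D_Aβ` on the chart
  have hΦ : dirac cfg.conn (h.alphaFun hs hnd cfg • h.canonicalSpinor hs hnd) i x = -dirac cfg.conn (h.betaField hs hnd cfg) i x := by
    rw [h.dirac_betaField_eq_of_isSolution hs hnd hcl hsol i hx, h.dirac_smul_canonicalSpinor_eq hs hnd hcl cfg i hx, neg_neg]
  have hX := h.crossTerm_pointwise hs hnd cfg i hx
  have hL := h.localLaplacian_taubesConnection_canonicalSpinor hs hnd hcl i hx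
  have hC := h.re_curvature_pairing_cross_eq hs hnd c hsol i hx
  rw [SpincStructure.diracField_toFun, hdd, hW, hΦ, hL, dotProduct_neg, Complex.neg_re,
    star_dotProduct_self_eq_spinorHermNormSq, Complex.ofReal_re]
  -- the `κ`-terms pair to zero with `β`, `ᾱβ`
  have hκ1 : (star ((h.betaField hs hnd cfg).toFun i x) ⬝ᵥ (((4 : ℂ)⁻¹ * (((h.canonicalSpincStructure hs hnd).frameScalarCurv i x : ℝ) : ℂ)) • (h.alphaFun hs hnd cfg • h.canonicalSpinor hs hnd).toFun i x)).re = 0 := by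
    rw [h.star_betaField_dotProduct hs hnd cfg i hx]
    simp
  have hκ0 : (star (((fun y ↦ conj (h.alphaFun hs hnd cfg y)) • h.betaField hs hnd cfg).toFun i x) ⬝ᵥ (-(((4 : ℂ)⁻¹ * (((h.canonicalSpincStructure hs hnd).frameScalarCurv i x : ℝ) : ℂ)) • plusUnit) -
      ((2 : ℂ)⁻¹ * I) • (cliffordTwoForm ((h.canonicalSpincStructure hs hnd).extDerivMatrix ((h.taubesConnection hs hnd).form i) i x) *ᵥ plusUnit))).re =
      -(star (((fun y ↦ conj (h.alphaFun hs hnd cfg y)) • h.betaField hs hnd cfg).toFun i x) ⬝ᵥ (((2 : ℂ)⁻¹ * I) •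
        (cliffordTwoForm ((h.canonicalSpincStructure hs hnd).extDerivMatrix ((h.taubesConnection hs hnd).form i) i x) *ᵥ (h.canonicalSpinor hs hnd).toFun i x))).re := by
    rw [dotProduct_sub, dotProduct_neg, Complex.sub_re, Complex.neg_re, canonicalSpinor_toFun,
      h.star_conj_alphaFun_smul_betaField_dotProduct hs hnd cfg i hx]
    simp
  rw [dotProduct_add, dotProduct_add, Complex.add_re, Complex.add_re, hκ1, hκ0]
  linarith [hX, hC]

/-- **Hutchings–Taubes (4.15) for the family**: for a solution `(A, ψ = αu₀ + β)` of `(SW)` with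
perturbation `P₊F_{A₀} - (r/4)s`, with `θ_k = ∇'_{e_k}α`, `b_k = b(e_k)` (Taubes's torsion), `β = ψ_{u₁}`
read in the unitary frame of the chart at the point,
`∫_N (|D_Aβ|² + ½|α|²|β|² - 2Σ_k Re(θ_k b_k β̄))(s ∧ s) = 0`. [cite: HutchingsTaubes2006, §4.5 (4.15)]
[cite: Taubes1994, §3 (17)–(18)] -/
theorem integral_crossTerm_eq_zero [T2Space N] [CompactSpace N] [(h.metric hs).HasLeviCivita]
    (hcl : IsClosedForm s) (c : ℂ) {cfg : (h.canonicalSpincStructure hs hnd).Configuration}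
    (hsol : SpincStructure.IsSolution (h.taubesPerturbation hs hnd - h.symplecticPerturbation hs hnd (Complex.normSq c / 4)) cfg) :
    MForm.integral (rayFamily (wedge_self_castDeg_apply_ne_zero s hnd))
      ((fun x ↦
        spinorHermNormSq (dirac cfg.conn (h.betaField hs hnd cfg) ((h.canonicalSpincStructure hs hnd).indexAt x) x) +
          2⁻¹ * Complex.normSq (h.alphaFun hs hnd cfg x) * h.betaSq hs hnd cfg x -
          2 * ∑ k, (connDeriv (h.alphaFun hs hnd cfg) (h.halfConnectionDiff hs hnd cfg) x ((h.canonicalSpincStructure hs hnd).frame ((h.canonicalSpincStructure hs hnd).indexAt x) k x) *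
            (h.unitaryAdaptedFrames hs hnd).canonicalTorsion ((h.canonicalSpincStructure hs hnd).indexAt x) x ((h.canonicalSpincStructure hs hnd).frame ((h.canonicalSpincStructure hs hnd).indexAt x) k x) *
              conj (cfg.plusSpinor ((h.canonicalSpincStructure hs hnd).indexAt x) x 0)).re) •
        (s.wedge s).castDeg two_add_two_eq_four) = 0 := by
  have hv : IsSmoothForm ((s.wedge s).castDeg two_add_two_eq_four) := (wedge_self_castDeg_mem_closedSmoothForms ⟨hs, hcl⟩).1
  have hne := wedge_self_castDeg_apply_ne_zero s hnd
  have hαu : (h.alphaFun hs hnd cfg • h.canonicalSpinor hs hnd).IsSmooth := (h.isSmooth_canonicalSpinor hs hnd).smulFun (h.contMDiff_alphaFun hs hnd cfg)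
  have hβ := h.isSmooth_betaField hs hnd cfg
  have hcβ : ((fun y ↦ conj (h.alphaFun hs hnd cfg y)) • h.betaField hs hnd cfg).IsSmooth :=
    hβ.smulFun ((Complex.conjCLE : ℂ ≃L[ℝ] ℂ).contDiff.comp_contMDiff (h.contMDiff_alphaFun hs hnd cfg))
  have hΦ := (h.canonicalSpincStructure hs hnd).isSmooth_diracField cfg.conn hαu
  have hu := h.isSmooth_canonicalSpinor hs hnd
  -- the three divergences, their smoothness and vanishing integrals
  obtain ⟨f₁, hf₁⟩ : ∃ f : N → ℝ, f = h.divergence hs hnd ((h.canonicalSpincStructure hs hnd).cliffordPairingForm ((h.canonicalSpincStructure hs hnd).diracField cfg.conn hαu) (h.betaField hs hnd cfg)) := ⟨_, rfl⟩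
  obtain ⟨f₂, hf₂⟩ : ∃ f : N → ℝ, f = h.divergence hs hnd ((h.canonicalSpincStructure hs hnd).covDerivPairingForm cfg.conn (h.alphaFun hs hnd cfg • h.canonicalSpinor hs hnd) (h.betaField hs hnd cfg)) := ⟨_, rfl⟩
  obtain ⟨f₃, hf₃⟩ : ∃ f : N → ℝ, f = h.divergence hs hnd ((h.canonicalSpincStructure hs hnd).covDerivPairingForm (h.taubesConnection hs hnd) (h.canonicalSpinor hs hnd) ((fun y ↦ conj (h.alphaFun hs hnd cfg y)) • h.betaField hs hnd cfg)) := ⟨_, rfl⟩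
  have hθ₁ : IsSmoothForm ((h.canonicalSpincStructure hs hnd).cliffordPairingForm ((h.canonicalSpincStructure hs hnd).diracField cfg.conn hαu) (h.betaField hs hnd cfg)).toMForm :=
    fun x ↦ (h.canonicalSpincStructure hs hnd).smoothAt_cliffordPairingForm hΦ hβ x
  have hθ₂ : IsSmoothForm ((h.canonicalSpincStructure hs hnd).covDerivPairingForm cfg.conn (h.alphaFun hs hnd cfg • h.canonicalSpinor hs hnd) (h.betaField hs hnd cfg)).toMForm :=
    fun x ↦ (h.canonicalSpincStructure hs hnd).smoothAt_covDerivPairingForm cfg.conn hαu hβ x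
  have hθ₃ : IsSmoothForm ((h.canonicalSpincStructure hs hnd).covDerivPairingForm (h.taubesConnection hs hnd) (h.canonicalSpinor hs hnd) ((fun y ↦ conj (h.alphaFun hs hnd cfg y)) • h.betaField hs hnd cfg)).toMForm :=
    fun x ↦ (h.canonicalSpincStructure hs hnd).smoothAt_covDerivPairingForm (h.taubesConnection hs hnd) hu hcβ x
  have hs₁ : ContMDiff (𝓡 4) 𝓘(ℝ, ℝ) ∞ f₁ := hf₁ ▸ h.contMDiff_divergence hs hnd hθ₁
  have hs₂ : ContMDiff (𝓡 4) 𝓘(ℝ, ℝ) ∞ f₂ := hf₂ ▸ h.contMDiff_divergence hs hnd hθ₂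
  have hs₃ : ContMDiff (𝓡 4) 𝓘(ℝ, ℝ) ∞ f₃ := hf₃ ▸ h.contMDiff_divergence hs hnd hθ₃
  have hI₁ : MForm.integral (rayFamily hne) (f₁ • (s.wedge s).castDeg two_add_two_eq_four) = 0 :=
    hf₁ ▸ h.integral_divergence_smul_wedge_self_eq_zero hs hnd hcl hθ₁
  have hI₂ : MForm.integral (rayFamily hne) (f₂ • (s.wedge s).castDeg two_add_two_eq_four) = 0 :=
    hf₂ ▸ h.integral_divergence_smul_wedge_self_eq_zero hs hnd hcl hθ₂
  have hI₃ : MForm.integral (rayFamily hne) (f₃ • (s.wedge s).castDeg two_add_two_eq_four) = 0 :=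
    hf₃ ▸ h.integral_divergence_smul_wedge_self_eq_zero hs hnd hcl hθ₃
  have hsum : MForm.integral (rayFamily hne) ((fun x ↦ f₁ x + f₂ x - f₃ x) • (s.wedge s).castDeg two_add_two_eq_four) = 0 := by
    have heq : ((fun x ↦ f₁ x + f₂ x - f₃ x) • (s.wedge s).castDeg two_add_two_eq_four : MForm (𝓡 4) N ℝ 4) =
        f₁ • (s.wedge s).castDeg two_add_two_eq_four + f₂ • (s.wedge s).castDeg two_add_two_eq_four +
          (-1 : ℝ) • (f₃ • (s.wedge s).castDeg two_add_two_eq_four) := by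
      funext x
      ext w
      simp [add_mul, sub_eq_add_neg]
    rw [heq, MForm.integral_add_holds _ (isContinuousOrientation_rayFamily hv hne)
      ((isSmoothForm_fun_smul hv hs₁).add (isSmoothForm_fun_smul hv hs₂)) ((isSmoothForm_fun_smul hv hs₃).smul _),
      MForm.integral_add_holds _ (isContinuousOrientation_rayFamily hv hne) (isSmoothForm_fun_smul hv hs₁) (isSmoothForm_fun_smul hv hs₂),
      MForm.integral_smul, hI₁, hI₂, hI₃]
    ring
  -- the pointwise identity
  have hpt : ∀ x, f₁ x + f₂ x - f₃ x =
      spinorHermNormSq (dirac cfg.conn (h.betaField hs hnd cfg) ((h.canonicalSpincStructure hs hnd).indexAt x) x) +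
        2⁻¹ * Complex.normSq (h.alphaFun hs hnd cfg x) * h.betaSq hs hnd cfg x -
        2 * ∑ k, (connDeriv (h.alphaFun hs hnd cfg) (h.halfConnectionDiff hs hnd cfg) x ((h.canonicalSpincStructure hs hnd).frame ((h.canonicalSpincStructure hs hnd).indexAt x) k x) *
          (h.unitaryAdaptedFrames hs hnd).canonicalTorsion ((h.canonicalSpincStructure hs hnd).indexAt x) x ((h.canonicalSpincStructure hs hnd).frame ((h.canonicalSpincStructure hs hnd).indexAt x) k x) *
            conj (cfg.plusSpinor ((h.canonicalSpincStructure hs hnd).indexAt x) x 0)).re := by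
    intro x
    have hi := (h.canonicalSpincStructure hs hnd).mem_baseSet_indexAt x
    rw [hf₁, hf₂, hf₃, h.divergence_cliffordPairingForm_eq hs hnd cfg.conn hΦ hβ, h.divergence_covDerivPairingForm_eq hs hnd cfg.conn hαu hβ,
      h.divergence_covDerivPairingForm_eq hs hnd (h.taubesConnection hs hnd) hu hcβ]
    beta_reduce
    exact (h.crossTerm_integrand_eq hs hnd hcl c hsol _ hi).symm
  have hfun : (fun x ↦ f₁ x + f₂ x - f₃ x) = _ := funext hpt
  rw [hfun] at hsum
  exact hsum

end AlmostComplexStructure.IsCompatibleWith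

end Literature.Geometry.Symplectic

end
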